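import Literature.NumberTheory.Sieve.Maynard2016Prop92Support
import Literature.NumberTheory.Sieve.FGKMT2018SingularSeriesSplitting
import Literature.NumberTheory.Sieve.FGKMT2018MainTermPrefactor
import Literature.NumberTheory.Sieve.FGKMT2018Prop91EDiffPointwise
import Literature.NumberTheory.Sieve.FGKMT2018Section8Toolbox
import HarnessLib

/-!
# Maynard 2016, Proposition 9.2 for `𝒜 = ℤ` — DECOMPOSITION OF THE MAIN PART (`y^{(m)}`, Lemma 9.3)

Sources: J. Maynard, *Dense clusters of primes in subsets*, Compositio Math. 152 (2016) 1517–1554 =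
arXiv:1405.2593 [Maynard2016DenseClusters], proof of Proposition 9.2, pp. 21–23 (displays
(9.10)–(9.22)) and Lemma 9.3 (statement p. 22, proof pp. 23–24); K. Ford, B. Green, S. Konyagin,
J. Maynard, T. Tao, *Long gaps between primes*, JAMS 31 (2018) [FordGreenKonyaginMaynardTao2018],
Theorem 6 (7.13).

`Maynard2016Prop92Decomposition` reduced the leaf `prop92Z` to an error part (Hypothesis 1) and the
**main part** `Maynard2016Prop92MainPart`:
`φ_ω(W)/φ_L(W) · Q_m = (1 + O(log^{−1/10} X)) · mainCoeffB`, `Q_m = primeQF` the quadratic form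
`∑'_{d,e ∈ 𝒟'_k, d_m=e_m=1} λ_d λ_e/φ_L([d,e])` (display (9.9)). This file types the printed route
through the main part as named leaves over pinned definitions and PROVES their assembly:

* `yVarM` — the change of variables (9.10)
  `y^{(m)}_r = μ(r) φ_ω(r) ∑_{d ∈ 𝒟'_k, r ∣ d, d_m = 1} λ_d/φ_L(d)`;
* `localPairSumM` — the inner sum `T^{(m)}(r,s) = ∑'_{d∣r, e∣s} μ(d)μ(e) φ_L(d)φ_L(e)/φ_L([d,e])` of
  (9.11), whose Euler factors are the `S_p^{(m)} ∈ {φ_L(p) − 1, −1, 0}` of (9.12);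
* `Maynard2016Prop92Regroup` (leaf M1, exact algebra, pp. 21–22): substituting
  `λ_d = μ(d) φ_L(d) ∑_{d∣r} y^{(m)}_r/φ_ω(r)` and using `∑_s T^{(m)}(r,s) = φ_ω(r)` (the count (9.15)),
  `Q_m = ∑_r (y^{(m)}_r)²/φ_ω(r) + ∑_{r,s} y^{(m)}_r (y^{(m)}_s − y^{(m)}_r) T^{(m)}(r,s)/φ_ω(r)²`
  (`ySqSumM + ediffM`) — the `φ_L`-twisted twin of `FGKMT2018MainTermRegroup.quadForm_regroup`;
* `Maynard2016Lemma93Z` (shared sub-leaf M2 = Lemma 9.3, (9.14)): in the frame,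
  `y^{(m)}_r = (log R) c_m ∫₀^∞ F dt_m + O(T_k (log log R)² c_m ∫₀^∞ F₂ dt_m)`,
  `c_m = φ(|a_m|WB) W^{k−1}B^{k−1} 𝔖_{WB}/(|a_m| φ(WB)^k)` (`cM`, `margF`, `margF₂`) — it feeds M3 and
  M4 and is NOT a hypothesis of the assembly;
* `Maynard2016Prop92EDiffBound` (leaf M3, pp. 22–23: the `y^{(m)}_s − y^{(m)}_r` terms, «analogously
  to Lemma 8.2», Lemma 8.4 against the slice `∫_{t_m=0} F₂²`): in the frame
  `|ediffM| ≤ K log^{−1/10} X · mainCoeffM`;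
* `Maynard2016Prop92YSqSum` (leaf M4, p. 23, displays (9.19)–(9.21): Lemma 9.3, Lemma 8.4 in the
  `k − 1` live variables, `J_k(H) = J_k(F)(1 + O(k²T_k log log R/log R))`, Lemma 8.6):
  `∑_r (y^{(m)}_r)²/φ_ω(r) = (1 + O(log^{−1/10} X)) · mainCoeffM`, where
  `mainCoeffM = (log R)^{k+1} W^{k−1}B^{k−1} 𝔖_{WB}(𝓛)/φ(WB)^{k−1} · J_k · ∏_{p∣a_m, p∤WB} (p−1)/p`
  is the right side of (9.21);
* `phiOmega_div_totForm_mul_mainCoeffM` (M5, PROVED here): «summing over the `φ_ω(W)` residue classes …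
  recalling `(W,B) = 1`» — `φ_ω(W)/φ_L(W) · mainCoeffM = mainCoeffB` for `(a_m, B) = 1`, by the
  singular-series splitting `𝔖_B = (φ_ω(W)/W)(W/φ(W))^k 𝔖_{WB}` and
  `φ(|a_m| W) = |a_m| φ(W) ∏_{p ∣ a_m, p ∤ W}(1 − 1/p)`;
* `maynard2016Prop92MainPart_of_leaves` (PROVED): `M1 → M3 → M4 → Maynard2016Prop92MainPart`
  (`K = K₃ + K₄`, `φ_ω(W)/φ_L(W) ≥ 0`).

## References
* J. Maynard, *Dense clusters of primes in subsets*, Compositio Math. 152 (2016), Prop. 9.2 (proof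
  pp. 21–23), Lemma 9.3 (pp. 22–24) [Maynard2016DenseClusters].
* K. Ford, B. Green, S. Konyagin, J. Maynard, T. Tao, *Long gaps between primes*, JAMS 31 (2018),
  Theorem 6 (7.13) [FordGreenKonyaginMaynardTao2018].
-/

noncomputable section

open Finset Filter
open scoped ArithmeticFunction.Moebius

namespace Literature.NumberTheory.Sieve

open FGKMT2018

namespace FGKMT2018

variable {k : ℕ}

/-! ### The pinned objects of the main part -/

/-- The change of variables (9.10): `y^{(m)}_r = μ(r) φ_ω(r) ∑_{d ∈ 𝒟'_k, r ∣ d, d_m = 1} λ_d/φ_L(d)`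
(`r = ∏ rᵢ`, `φ_L(d) = φ(|a_m| d)/φ(|a_m|)`; intended for `r ∈ 𝒟'_k` with `r_m = 1`, i.e. `r ∈ dkBoxP`).
[cite: Maynard2016DenseClusters, proof of Prop. 9.2 p. 21, display (9.10)] -/
def yVarM (L : Fin k → ℤ × ℤ) (B : ℕ) (R : ℝ) (F : (Fin k → ℝ) → ℝ) (m : Fin k)
    (r : Fin k → ℕ) : ℝ :=
  ((μ (∏ i, r i) : ℤ) : ℝ) * phiOmega L (∏ i, r i) *
    ∑ d ∈ (dkBoxP L B R m).filter (fun d => ∀ i, r i ∣ d i),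
      lamVar L B R F d / totForm (L m) (∏ i, d i)

/-- The inner sum of (9.11): `T^{(m)}(r,s) = ∑'_{d ∣ r, e ∣ s; d, e ∈ 𝒟'_k, d_m = e_m = 1}
μ(d)μ(e) φ_L(d)φ_L(e)/φ_L(∏ᵢ[dᵢ,eᵢ])` (cross-coprime pairs), whose Euler factors are the
`S_p^{(m)}` of (9.12). [cite: Maynard2016DenseClusters, proof of Prop. 9.2 pp. 21–22, displays (9.11)–(9.12)] -/
def localPairSumM (L : Fin k → ℤ × ℤ) (B : ℕ) (R : ℝ) (m : Fin k) (r s : Fin k → ℕ) : ℝ :=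
  ∑ d ∈ (dkBoxP L B R m).filter (fun d => ∀ i, d i ∣ r i),
    ∑ e ∈ (dkBoxP L B R m).filter (fun e => ∀ i, e i ∣ s i),
      if ∀ i j, i ≠ j → (d i * e i).Coprime (d j * e j) then
        ((μ (∏ i, d i) : ℤ) : ℝ) * ((μ (∏ i, e i) : ℤ) : ℝ) *
            (totForm (L m) (∏ i, d i) * totForm (L m) (∏ i, e i)) /
          totForm (L m) (∏ i, Nat.lcm (d i) (e i))
      else 0

/-- The diagonal sum `∑_{r ∈ 𝒟'_k, r_m = 1} (y^{(m)}_r)²/φ_ω(r)` (display (9.15), right side).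
[cite: Maynard2016DenseClusters, proof of Prop. 9.2 p. 22, display (9.15)] -/
def ySqSumM (L : Fin k → ℤ × ℤ) (B : ℕ) (R : ℝ) (F : (Fin k → ℝ) → ℝ) (m : Fin k) : ℝ :=
  ∑ r ∈ dkBoxP L B R m, yVarM L B R F m r ^ 2 / phiOmega L (∏ i, r i)

/-- The difference part `∑_{r,s} y^{(m)}_r (y^{(m)}_s − y^{(m)}_r) T^{(m)}(r,s)/φ_ω(r)²` of the
regrouped quadratic form (the terms bounded on pp. 22–23 «analogously to Lemma 8.2»).
[cite: Maynard2016DenseClusters, proof of Prop. 9.2 pp. 22–23, displays (9.13), (9.16)–(9.18)] -/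
def ediffM (L : Fin k → ℤ × ℤ) (B : ℕ) (R : ℝ) (F : (Fin k → ℝ) → ℝ) (m : Fin k) : ℝ :=
  ∑ r ∈ dkBoxP L B R m, ∑ s ∈ dkBoxP L B R m,
    yVarM L B R F m r * (yVarM L B R F m s - yVarM L B R F m r) / phiOmega L (∏ i, r i) ^ 2 *
      localPairSumM L B R m r s

/-- The right side of (9.21) divided by `(1 + O(log^{−1/10}))`:
`mainCoeffM = (WB)^{k−1}/φ(WB)^{k−1} · 𝔖_{WB}(𝓛) · ∏_{p ∣ a_m, p ∤ WB} (p−1)/p · (log R)^{k+1} · J`.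
[cite: Maynard2016DenseClusters, proof of Prop. 9.2 p. 23, display (9.21)] -/
def mainCoeffM (L : Fin k → ℤ × ℤ) (B : ℕ) (R J : ℝ) (m : Fin k) : ℝ :=
  ((wCut k B * B : ℕ) : ℝ) ^ (k - 1) / (Nat.totient (wCut k B * B) : ℝ) ^ (k - 1) *
    singSeriesExcl L (wCut k B * B) *
    (∏ p ∈ (L m).1.natAbs.primeFactors.filter (fun p => ¬ p ∣ wCut k B * B),
      (((p : ℝ) - 1) / p)) *
    Real.log R ^ (k + 1) * J

/-- The constant of Lemma 9.3: `c_m = φ(|a_m| W B) W^{k−1} B^{k−1} 𝔖_{WB}(𝓛)/(|a_m| φ(WB)^k)`.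
[cite: Maynard2016DenseClusters, Lemma 9.3 p. 22, display (9.14)] -/
def cM (L : Fin k → ℤ × ℤ) (B : ℕ) (m : Fin k) : ℝ :=
  (Nat.totient ((L m).1.natAbs * (wCut k B * B)) : ℝ) * ((wCut k B * B : ℕ) : ℝ) ^ (k - 1) *
      singSeriesExcl L (wCut k B * B) /
    ((L m).1.natAbs * (Nat.totient (wCut k B * B) : ℝ) ^ k)

/-- The fibre integral `∫₀^∞ G(u; u_m := t) dt` of Lemma 9.3 (`∫ H dt_m`); for `G = F_k` it equals
`H_ψ(∑_{j≠m} u_j) ∏_{j≠m} g_k(u_j)` (`MaynardDense.inner_F_eq_Hpsi`).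
[cite: Maynard2016DenseClusters, Lemma 9.3 p. 22, display (9.14)] -/
def margInt (m : Fin k) (G : (Fin k → ℝ) → ℝ) (u : Fin k → ℝ) : ℝ :=
  ∫ t in Set.Ici (0 : ℝ), G (Function.update u m t)

end FGKMT2018

/-! ### The leaves -/

/-- **Leaf M1 [Maynard2016DenseClusters, proof of Prop. 9.2 pp. 21–22, displays (9.10)–(9.13), (9.15)]**
(exact algebra, any `F`, any `B`): inverting (9.10) on the divisor-closed set `𝒟'_k ∩ {d_m = 1}`,
`λ_d = μ(d) φ_L(d) ∑_{d ∣ r} y^{(m)}_r/φ_ω(r)`, so `Q_m = ∑_{r,s} y^{(m)}_r y^{(m)}_s T^{(m)}(r,s)/(φ_ω(r)φ_ω(s))`;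
`T^{(m)}(r,s) = 0` unless `r = s` (as integers; `S_p^{(m)} = 0` when `p` divides exactly one of `r, s`),
`φ_ω(s) = φ_ω(r)` then, and `∑_s T^{(m)}(r,s) = ∏_{p∣r}((φ_L(p) − 1) − #{other admissible coordinates}) = φ_ω(r)`
(the count (9.15): `ω(p) − 2` resp. `ω(p) − 1` other coordinates according as `p ∤ a_m`, `p ∣ a_m`);
`y_r = 0` for `∏ rᵢ > R` takes care of the box truncation. Hence
`Q_m = ∑_r (y^{(m)}_r)²/φ_ω(r) + ∑_{r,s} y^{(m)}_r (y^{(m)}_s − y^{(m)}_r) T^{(m)}(r,s)/φ_ω(r)²` —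
the `φ_L`-twisted twin of `FGKMT2018MainTermRegroup.quadForm_regroup` (Prop. 9.1, (9.2)–(9.5)).
[cite: Maynard2016DenseClusters, proof of Prop. 9.2 pp. 21–22, displays (9.10)–(9.13), (9.15); proof of Prop. 9.1 p. 19, (9.2)–(9.5)] -/
def Maynard2016Prop92Regroup : Prop :=
  ∀ (k : ℕ) (L : Fin k → ℤ × ℤ), FormsAdmissible L → ∀ (B : ℕ) (R : ℝ), 1 < R →
    ∀ (F : (Fin k → ℝ) → ℝ) (m : Fin k),
      FGKMT2018.primeQF L B R F m = FGKMT2018.ySqSumM L B R F m + FGKMT2018.ediffM L B R F m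

/-- **Shared sub-leaf M2 = [Maynard2016DenseClusters, Lemma 9.3 p. 22, display (9.14); proof pp. 23–24]**
for `𝒜 = ℤ`, `F = F_k`, in the frame of [FGKMT, Thm 6]: for `r ∈ 𝒟'_k`, `r_m = 1`,
`y^{(m)}_r = (log R) c_m ∫₀^∞ H(u(r); t_m) dt_m`, `H = F + O(T_k (log log R)²/log R · F₂)`, i.e.
`|y^{(m)}_r − (log R) c_m ∫ F dt_m| ≤ K T_k (log log R)² c_m ∫ F₂ dt_m` (`u(r) = (log rᵢ/log R)ᵢ`).
Printed proof: substitute (8.6), local factors `S'^{(m)}_p ∈ {−1/(p−1), 0, 1}` (9.24), `e_j = r_j s_j t_j`,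
Lemma 8.2 for `y_e − y_{r'}`, the `(s,t)` Euler product (9.27) with the `t ∣ W'/W` sum costing
`(log log R)²`, and the `e_m`-summation by Lemma 8.3 (tree: `MaynardDense.lemma83_gamma84_dec`,
`abs_F_update_sub_le`). This statement feeds leaves M3 and M4; it is not a hypothesis of the assembly.
[cite: Maynard2016DenseClusters, Lemma 9.3 p. 22 (9.14), proof pp. 23–24 (9.23)–(9.30), Lemmas 8.2–8.3 pp. 15–17] -/
def Maynard2016Lemma93Z : Prop :=
  ∃ (C : ℕ) (K : ℝ), 0 < K ∧ FGKMT2018.Prop61Frame C fun B k L _X R =>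
    ∀ m : Fin k, Nat.Coprime (L m).1.natAbs B → ∀ r ∈ FGKMT2018.dkBoxP L B R m,
      |FGKMT2018.yVarM L B R (MaynardDense.F k) m r -
          Real.log R * FGKMT2018.cM L B m * FGKMT2018.margInt m (MaynardDense.F k) (FGKMT2018.logVec R r)|
        ≤ K * MaynardDense.T k * Real.log (Real.log R) ^ 2 * FGKMT2018.cM L B m *
          FGKMT2018.margInt m (MaynardDense.F₂ k) (FGKMT2018.logVec R r)

/-- **Leaf M3 [Maynard2016DenseClusters, proof of Prop. 9.2 pp. 22–23, displays (9.16)–(9.18)]** for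
`𝒜 = ℤ`, `F = F_k`, in the frame: the difference terms are `O(log^{−1/10} X)` of the main coefficient,
`|∑_{r,s} y^{(m)}_r (y^{(m)}_s − y^{(m)}_r) T^{(m)}(r,s)/φ_ω(r)²| ≤ K log^{−1/10} X · mainCoeffM`.
Printed: `y^{(m)}_s = y^{(m)}_r + O(T_k/k · (Y_r + Y_s) φ(a_mWB)(log A)(log log R)²/(a_m WB))`
«analogously to Lemma 8.2» (from Lemma 9.3), the `A = A(r,s)` bookkeeping, Cauchy–Schwarz, Lemma 8.4
against the slice `∫_{t_m = 0} F₂² ≪ k² T_k² J_k(F)` (tree `MaynardDense.sliceI_F₂_le'`), total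
`≪ T_k³ (log log R)²/log R` relative, and `k ≤ log^{1/5} x`, `R ≥ X^{1/30}`.
[cite: Maynard2016DenseClusters, proof of Prop. 9.2 pp. 22–23 (9.16)–(9.18), Lemma 8.4 p. 17, Lemma 8.6 p. 18] -/
def Maynard2016Prop92EDiffBound : Prop :=
  ∃ (C : ℕ) (K : ℝ), 0 < K ∧ FGKMT2018.Prop61Frame C fun B k L X R =>
    ∀ m : Fin k, Nat.Coprime (L m).1.natAbs B →
      |FGKMT2018.ediffM L B R (MaynardDense.F k) m|
        ≤ K / Real.log X ^ ((1 : ℝ) / 10) * FGKMT2018.mainCoeffM L B R (MaynardDense.JF k) m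

/-- **Leaf M4 [Maynard2016DenseClusters, proof of Prop. 9.2 p. 23, displays (9.19)–(9.21)]** for
`𝒜 = ℤ`, `F = F_k`, in the frame: `∑_{r ∈ 𝒟'_k, r_m=1} (y^{(m)}_r)²/φ_ω(r)
= (1 + O(log^{−1/10} X)) (log R)^{k+1} W^{k−1}B^{k−1} 𝔖_{WB}(𝓛)/φ(WB)^{k−1} J_k(F) ∏_{p∣a_m, p∤WB}(p−1)/p`.
Printed: Lemma 9.3, Lemma 8.4 (tree `MaynardDense.lemma84_all'_dec` with `Φ = H_ψ²`:
`lemma84_hypPhi_Hpsi_sq`, `orthInt_profExt_sq_Hpsi_sq`), `J_k(H) = J_k(F)(1 + O(k²T_k log log R/log R))`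
by `J_k(F₂) ≪ k² J_k(F)` (`lemma86_J_F₂_le'`), `J_k(F₁) ≍ J_k(F)`, and the simplification of the Euler
products (9.19) → (9.21).
[cite: Maynard2016DenseClusters, proof of Prop. 9.2 p. 23 (9.19)–(9.21), Lemma 9.3 p. 22, Lemma 8.4 p. 17, Lemma 8.6 p. 18] -/
def Maynard2016Prop92YSqSum : Prop :=
  ∃ (C : ℕ) (K : ℝ), 0 < K ∧ FGKMT2018.Prop61Frame C fun B k L X R =>
    ∀ m : Fin k, Nat.Coprime (L m).1.natAbs B →
      |FGKMT2018.ySqSumM L B R (MaynardDense.F k) m - FGKMT2018.mainCoeffM L B R (MaynardDense.JF k) m|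
        ≤ K / Real.log X ^ ((1 : ℝ) / 10) * FGKMT2018.mainCoeffM L B R (MaynardDense.JF k) m

namespace FGKMT2018

variable {k : ℕ}

/-! ### M5: the prefactor identity `φ_ω(W)/φ_L(W) · mainCoeffM = mainCoeffB` for `(a_m, B) = 1` -/

/-- `φ(a W) = a φ(W) ∏_{p ∣ a, p ∤ W} (1 − 1/p)` (`a, W ≠ 0`).
[cite: Maynard2016DenseClusters, proof of Prop. 9.2 p. 23 («summing over the φ_ω(W) residue classes»)] -/
theorem cast_totient_mul_eq_prod_filter {a W : ℕ} (ha : a ≠ 0) (hW : W ≠ 0) :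
    (Nat.totient (a * W) : ℝ) =
      a * Nat.totient W * ∏ p ∈ a.primeFactors.filter (fun p => ¬ p ∣ W), (1 - 1 / (p : ℝ)) := by
  rw [LFunctions.Zhang2022.totient_eq_mul_prod_real (a * W), LFunctions.Zhang2022.totient_eq_mul_prod_real W, Nat.primeFactors_mul ha hW]
  have hsplit : a.primeFactors ∪ W.primeFactors =
      W.primeFactors ∪ a.primeFactors.filter (fun p => ¬ p ∣ W) := by
    ext p
    simp only [Finset.mem_union, Finset.mem_filter, Nat.mem_primeFactors_of_ne_zero ha,
      Nat.mem_primeFactors_of_ne_zero hW]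
    tauto
  have hdisj : Disjoint W.primeFactors (a.primeFactors.filter (fun p => ¬ p ∣ W)) := by
    rw [Finset.disjoint_left]
    intro p hp hp'
    exact (Finset.mem_filter.1 hp').2 (Nat.dvd_of_mem_primeFactors hp)
  rw [hsplit, Finset.prod_union hdisj]
  push_cast
  ring

/-- `φ_L(W) = φ(W) ∏_{p ∣ a_m, p ∤ W}(1 − 1/p) · |a_m|/φ(|a_m|)`, i.e.
`φ(|a_m|) φ_L(W) = |a_m| φ(W) ∏_{p ∣ a_m, p ∤ W} (1 − 1/p)` (`a_m ≠ 0`, `W ≠ 0`).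
[cite: Maynard2016DenseClusters, proof of Prop. 9.2 p. 23; FordGreenKonyaginMaynardTao2018, §7 p. 20 (φ_L)] -/
theorem totient_mul_totForm_eq (l : ℤ × ℤ) (hl : l.1 ≠ 0) {W : ℕ} (hW : W ≠ 0) :
    (Nat.totient l.1.natAbs : ℝ) * totForm l W =
      l.1.natAbs * Nat.totient W *
        ∏ p ∈ l.1.natAbs.primeFactors.filter (fun p => ¬ p ∣ W), (1 - 1 / (p : ℝ)) := by
  have ha : l.1.natAbs ≠ 0 := Int.natAbs_ne_zero.2 hl
  have hφ : (Nat.totient l.1.natAbs : ℝ) ≠ 0 := by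
    exact_mod_cast (Nat.totient_pos.2 (Nat.pos_of_ne_zero ha)).ne'
  unfold totForm
  rw [mul_div_cancel₀ _ hφ, cast_totient_mul_eq_prod_filter ha hW]

/-- **M5 — «Summing over the `φ_ω(W)` residue classes … recalling `(W, B) = 1`»
[Maynard2016DenseClusters, proof of Prop. 9.2 p. 23, (9.21)–(9.22)]:** for admissible non-degenerate `𝓛`
and `(a_m, B) = 1`, `φ_ω(W)/φ_L(W) · mainCoeffM = mainCoeffB`, i.e.
`(φ_ω(W)/φ_L(W)) (WB)^{k−1}/φ(WB)^{k−1} 𝔖_{WB} ∏_{p∣a_m,p∤WB}(p−1)/p = (φ(|a_m|)/|a_m|)(B/φ(B))^{k−1} 𝔖_B`,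
by `𝔖_B = (φ_ω(W)/W)(W/φ(W))^k 𝔖_{WB}` (`singSeriesExcl_eq_phiOmega_mul`), `(W,B) = 1`
(`coprime_wCut_self`) and `φ(|a_m|W) = |a_m| φ(W) ∏_{p∣a_m, p∤W}(1 − 1/p)`.
[cite: Maynard2016DenseClusters, proof of Prop. 9.2 p. 23 (9.21)–(9.22), proof of Prop. 9.1 pp. 19–20 («the singular series cancel»); FordGreenKonyaginMaynardTao2018, Thm 6 (7.13) p. 21] -/
theorem phiOmega_div_totForm_mul_mainCoeffM {L : Fin k → ℤ × ℤ} (hadm : FormsAdmissible L)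
    (hnd : FormsNondegenerate L) {B : ℕ} (hB : B ≠ 0) (R J : ℝ) (m : Fin k)
    (hcop : Nat.Coprime (L m).1.natAbs B) :
    phiOmega L (wCut k B) / totForm (L m) (wCut k B) * mainCoeffM L B R J m = mainCoeffB L B R J m := by
  obtain ⟨n, rfl⟩ : ∃ n, k = n + 1 := ⟨k - 1, by have := m.pos; omega⟩
  have hW0 : wCut (n + 1) B ≠ 0 := (wCut_pos (n + 1) B).ne'
  have ha : (L m).1 ≠ 0 := hadm.1 m
  have haN : (L m).1.natAbs ≠ 0 := Int.natAbs_ne_zero.2 ha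
  have hWB : (wCut (n + 1) B).Coprime B := coprime_wCut_self (n + 1) B
  have hS := singSeriesExcl_eq_phiOmega_mul hadm hnd (squarefree_wCut (n + 1) B) hWB
  have ht : 0 < totForm (L m) (wCut (n + 1) B) := totForm_pos (L m) ha hW0
  have hφa : (0 : ℝ) < Nat.totient (L m).1.natAbs := by
    exact_mod_cast Nat.totient_pos.2 (Nat.pos_of_ne_zero haN)
  have hφW : (0 : ℝ) < Nat.totient (wCut (n + 1) B) := by exact_mod_cast Nat.totient_pos.2 (wCut_pos (n + 1) B)
  have hφB : (0 : ℝ) < Nat.totient B := by exact_mod_cast Nat.totient_pos.2 (Nat.pos_of_ne_zero hB)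
  have hWr : (0 : ℝ) < wCut (n + 1) B := by exact_mod_cast wCut_pos (n + 1) B
  have haR : (0 : ℝ) < (L m).1.natAbs := by exact_mod_cast Nat.pos_of_ne_zero haN
  -- the filter `p ∤ WB` on the primes of `a_m` is the filter `p ∤ W`, by `(a_m, B) = 1`
  have hfilt : (L m).1.natAbs.primeFactors.filter (fun p => ¬ p ∣ wCut (n + 1) B * B) =
      (L m).1.natAbs.primeFactors.filter (fun p => ¬ p ∣ wCut (n + 1) B) := by
    refine Finset.filter_congr fun p hp => ?_
    have hpP := Nat.prime_of_mem_primeFactors hp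
    have hpB : ¬ p ∣ B := fun h =>
      hpP.one_lt.ne' (Nat.eq_one_of_dvd_coprimes hcop (Nat.dvd_of_mem_primeFactors hp) h)
    constructor
    · exact fun h hW => h (dvd_mul_of_dvd_left hW B)
    · intro h hWB'
      rcases (Nat.Prime.dvd_mul hpP).1 hWB' with h1 | h1
      · exact h h1
      · exact hpB h1
  have hprod : ∏ p ∈ (L m).1.natAbs.primeFactors.filter (fun p => ¬ p ∣ wCut (n + 1) B),
      (((p : ℝ) - 1) / p) =
      ∏ p ∈ (L m).1.natAbs.primeFactors.filter (fun p => ¬ p ∣ wCut (n + 1) B), (1 - 1 / (p : ℝ)) := by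
    refine Finset.prod_congr rfl fun p hp => ?_
    have hp0 : (p : ℝ) ≠ 0 := by
      exact_mod_cast (Nat.prime_of_mem_primeFactors (Finset.mem_filter.1 hp).1).ne_zero
    field_simp
  have hkey := totient_mul_totForm_eq (L m) ha hW0
  have hP0 : (∏ p ∈ (L m).1.natAbs.primeFactors.filter (fun p => ¬ p ∣ wCut (n + 1) B),
      (1 - 1 / (p : ℝ))) ≠ 0 := by
    refine Finset.prod_ne_zero_iff.2 fun p hp => ?_
    have hp2 := (Nat.prime_of_mem_primeFactors (Finset.mem_filter.1 hp).1).two_le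
    have hp2' : (2 : ℝ) ≤ p := by exact_mod_cast hp2
    have : 1 / (p : ℝ) ≤ 1 / 2 := by
      rw [div_le_div_iff₀ (by linarith) (by norm_num)]; linarith
    linarith
  have hWBcast : ((wCut (n + 1) B * B : ℕ) : ℝ) = (wCut (n + 1) B : ℝ) * B := by push_cast; ring
  have hφWB : (Nat.totient (wCut (n + 1) B * B) : ℝ) = (Nat.totient (wCut (n + 1) B) : ℝ) * Nat.totient B := by
    rw [Nat.totient_mul hWB]; push_cast; ring
  have ht' : totForm (L m) (wCut (n + 1) B) =
      (L m).1.natAbs * Nat.totient (wCut (n + 1) B) *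
        (∏ p ∈ (L m).1.natAbs.primeFactors.filter (fun p => ¬ p ∣ wCut (n + 1) B), (1 - 1 / (p : ℝ))) /
        Nat.totient (L m).1.natAbs := by
    rw [eq_div_iff hφa.ne', mul_comm]; exact hkey
  unfold mainCoeffM mainCoeffB bOverPhi
  rw [hfilt, hprod, hS, hWBcast, hφWB, ht']
  simp only [Nat.add_sub_cancel, pow_succ, mul_pow, div_pow]
  field_simp

/-! ### The assembly of the main part -/

/-- `R > 1` in the frame: `x ≥ 4`, `X ≥ x/2 ≥ 2`, `R ≥ X^{1/30} > 1`.
[cite: FordGreenKonyaginMaynardTao2018, Thm 6 p. 21 (the ranges of X and R)] -/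
theorem one_lt_R_of_frame {x X R : ℝ} (hx : 4 ≤ x) (hX : x / 2 ≤ X)
    (hR : X ^ ((1 : ℝ) / 30) ≤ R) : 1 < R := by
  have hX2 : (2 : ℝ) ≤ X := by linarith
  have h1 : (1 : ℝ) < X ^ ((1 : ℝ) / 30) := Real.one_lt_rpow (by linarith) (by norm_num)
  linarith

end FGKMT2018

/-- **The main part of Proposition 9.2 for `𝒜 = ℤ` assembled from its leaves**:
`Maynard2016Prop92Regroup → Maynard2016Prop92EDiffBound → Maynard2016Prop92YSqSum → Maynard2016Prop92MainPart`.
In the frame: `Q_m = ySqSumM + ediffM` (M1), `|ySqSumM − mainCoeffM| + |ediffM| ≤ (K₃ + K₄) log^{−1/10} X · mainCoeffM`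
(M3, M4), multiplied by `φ_ω(W)/φ_L(W) ≥ 0` and rewritten with M5 (`φ_ω(W)/φ_L(W) · mainCoeffM = mainCoeffB`).
[cite: Maynard2016DenseClusters, proof of Prop. 9.2 pp. 21–23 («Thus, putting everything together», (9.22)); FordGreenKonyaginMaynardTao2018, Thm 6 (7.13) p. 21] -/
theorem maynard2016Prop92MainPart_of_leaves (h1 : Maynard2016Prop92Regroup)
    (h3 : Maynard2016Prop92EDiffBound) (h4 : Maynard2016Prop92YSqSum) : Maynard2016Prop92MainPart := by
  obtain ⟨C₃, K₃, hK₃, e3⟩ := h3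
  obtain ⟨C₄, K₄, hK₄, e4⟩ := h4
  refine ⟨max C₃ C₄, K₃ + K₄, by linarith, ?_⟩
  have h34 := e3.and e4
  unfold FGKMT2018.Prop61Frame at h34 ⊢
  filter_upwards [h34, eventually_ge_atTop 4] with x hx hx4 B hB hBx k L X R hCk hk hadm hnd hcoef
    hX1 hX2 hR1 hR2 m hcop
  obtain ⟨hxD, hxY⟩ := hx B hB hBx k L X R hCk hk hadm hnd hcoef hX1 hX2 hR1 hR2
  have eD := hxD m hcop
  have eY := hxY m hcop
  have hx4' : (4 : ℝ) ≤ x := by exact_mod_cast hx4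
  have hR : 1 < R := FGKMT2018.one_lt_R_of_frame hx4' hX1 hR1
  have hB0 : B ≠ 0 := by
    rcases hB with rfl | hB
    · exact one_ne_zero
    · exact hB.ne_zero
  have hX2' : (2 : ℝ) ≤ X := by linarith
  have hlogX : 0 < Real.log X := Real.log_pos (by linarith)
  have hu : 0 < Real.log X ^ ((1 : ℝ) / 10) := Real.rpow_pos_of_pos hlogX _
  have hQ := h1 k L hadm B R hR (MaynardDense.F k) m
  have hM5 := FGKMT2018.phiOmega_div_totForm_mul_mainCoeffM hadm hnd hB0 R (MaynardDense.JF k) m hcop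
  set c : ℝ := phiOmega L (wCut k B) / totForm (L m) (wCut k B) with hc
  set M : ℝ := FGKMT2018.mainCoeffM L B R (MaynardDense.JF k) m with hM
  set Y : ℝ := FGKMT2018.ySqSumM L B R (MaynardDense.F k) m with hY
  set D : ℝ := FGKMT2018.ediffM L B R (MaynardDense.F k) m with hD
  have hc0 : 0 ≤ c := by
    rw [hc]
    exact div_nonneg (phiOmega_wCut_nonneg L B)
      (FGKMT2018.totForm_pos (L m) (hadm.1 m) (FGKMT2018.wCut_pos k B).ne').le
  -- `mainCoeffM ≥ 0` is forced by the bound M4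
  have hM0 : 0 ≤ M := by
    by_contra hneg
    have : K₄ / Real.log X ^ ((1 : ℝ) / 10) * M < 0 :=
      mul_neg_of_pos_of_neg (div_pos hK₄ hu) (not_le.1 hneg)
    linarith [abs_nonneg (Y - M)]
  rw [hQ, ← hM5]
  have e : c * (Y + D) - c * M = c * ((Y - M) + D) := by ring
  rw [e, abs_mul, abs_of_nonneg hc0]
  calc c * |(Y - M) + D| ≤ c * (|Y - M| + |D|) := mul_le_mul_of_nonneg_left (abs_add_le _ _) hc0
    _ ≤ c * (K₄ / Real.log X ^ ((1 : ℝ) / 10) * M + K₃ / Real.log X ^ ((1 : ℝ) / 10) * M) :=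
        mul_le_mul_of_nonneg_left (add_le_add eY eD) hc0
    _ = (K₃ + K₄) / Real.log X ^ ((1 : ℝ) / 10) * (c * M) := by ring

end Literature.NumberTheory.Sieve
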